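import Mathlib.Analysis.Complex.CauchyIntegral
import Mathlib.MeasureTheory.Integral.IntervalIntegral.Basic
import HarnessLib

/-!
# Deforming a vertical segment into a staircase (Cauchy's theorem, rectangle by rectangle)

Topic `Literature/Analysis/Complex`. A bookkeeping form of Cauchy's theorem used whenever a Perron
integral `∫_{c−iT}^{c+iT} F(z) dz` is moved onto a piecewise-rectilinear path made of vertical
segments `Re z = s_j` on `t_j ≤ Im z ≤ t_{j+1}` joined by horizontal connectors at the heights `t_j`
(Soundararajan's contour for `M(x)`, arXiv:0705.0723 §5; Balazard–de Roton, arXiv:0810.3587 §8.2,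
"D'après le théorème de Cauchy, on a `A_N = ∫_{𝒮_N} ζ(z)^{-1} N^z dz/z`"; likewise arXiv:0812.1689
§6.2). For `f` holomorphic on the open half-plane `Re z > a`, abscissae `s_j > a`, `c > a` and any
heights `t_0, …, t_m`, summing Mathlib's `Complex.integral_boundary_rect_eq_zero_of_differentiableOn`
over the rectangles `[s_j, c] × [t_j, t_{j+1}]` telescopes into the exact identity

`I•∫_{t_0}^{t_m} f(c+iu) du = Σ_{j<m} I•∫_{t_j}^{t_{j+1}} f(s_j+iu) du + Σ_{1≤j<m} ∫_{s_{j−1}}^{s_j} f(v+it_j) dv`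
`                              + ∫_{s_{m−1}}^{c} f(v+it_m) dv − ∫_{s_0}^{c} f(v+it_0) dv`

(`Staircase.integral_vertical_eq_staircase`), and hence the bound of the segment integral by the
sum of the `L¹` norms of `f` on the pieces of the staircase (`Staircase.norm_integral_vertical_le`).
No path or contour object is introduced.

## References

* K. Soundararajan, Partial sums of the Möbius function, J. reine angew. Math. 631 (2009), §5.
* [BalazardRoton2008] M. Balazard, A. de Roton, arXiv:0810.3587, §8.2.
-/

noncomputable section

open Complex Set MeasureTheory intervalIntegral
open scoped Interval

namespace Literature.Analysis.Complex

namespace Staircase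

variable {f : ℂ → ℂ} {a c : ℝ}

/-- Continuity of `f` along a horizontal line `v ↦ f(v + it)` on `v > a`. [folklore] -/
lemma continuousOn_horizontal (hf : DifferentiableOn ℂ f {z : ℂ | a < z.re}) (t : ℝ) :
    ContinuousOn (fun v : ℝ ↦ f (v + t * I)) (Ioi a) := by
  refine hf.continuousOn.comp (by fun_prop) fun v hv ↦ ?_
  simpa using hv

/-- Continuity of `f` along a vertical line `u ↦ f(s + iu)` for `s > a`. [folklore] -/
lemma continuous_vertical (hf : DifferentiableOn ℂ f {z : ℂ | a < z.re}) {s : ℝ} (hs : a < s) :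
    Continuous fun u : ℝ ↦ f (s + u * I) := by
  have h : ContinuousOn (fun u : ℝ ↦ f (s + u * I)) univ := by
    refine hf.continuousOn.comp (by fun_prop) fun u _ ↦ ?_
    simpa using hs
  exact continuousOn_univ.1 h

/-- Interval integrability along horizontal segments inside the half-plane. [folklore] -/
lemma intervalIntegrable_horizontal (hf : DifferentiableOn ℂ f {z : ℂ | a < z.re}) (t : ℝ)
    {v₁ v₂ : ℝ} (h₁ : a < v₁) (h₂ : a < v₂) :
    IntervalIntegrable (fun v : ℝ ↦ f (v + t * I)) volume v₁ v₂ := by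
  refine ((continuousOn_horizontal hf t).mono ?_).intervalIntegrable
  intro v hv
  rcases le_total v₁ v₂ with h | h
  · rw [uIcc_of_le h] at hv; exact lt_of_lt_of_le h₁ hv.1
  · rw [uIcc_of_ge h] at hv; exact lt_of_lt_of_le h₂ hv.1

/-- **One rectangle** `[s, c] × [t₁, t₂]` (`s, c > a`):
`I•∫_{t₁}^{t₂} f(c+iu) du = I•∫_{t₁}^{t₂} f(s+iu) du − ∫_s^c f(v+it₁) dv + ∫_s^c f(v+it₂) dv`.
[folklore] -/
theorem integral_vertical_eq_rect (hf : DifferentiableOn ℂ f {z : ℂ | a < z.re}) (hc : a < c)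
    {s : ℝ} (hs : a < s) (t₁ t₂ : ℝ) :
    I • ∫ u in t₁..t₂, f (c + u * I) =
      I • (∫ u in t₁..t₂, f (s + u * I)) - (∫ v in s..c, f (v + t₁ * I)) + ∫ v in s..c, f (v + t₂ * I) := by
  have hsub : ([[s, c]] ×ℂ [[t₁, t₂]]) ⊆ {z : ℂ | a < z.re} := by
    intro z hz
    rw [mem_reProdIm] at hz
    have h1 := hz.1
    rcases le_total s c with h | h
    · rw [uIcc_of_le h] at h1; exact lt_of_lt_of_le hs h1.1
    · rw [uIcc_of_ge h] at h1; exact lt_of_lt_of_le hc h1.1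
  have h := Complex.integral_boundary_rect_eq_zero_of_differentiableOn f (s + t₁ * I) (c + t₂ * I)
    (hf.mono (by simpa using hsub))
  simp only [add_re, ofReal_re, mul_re, I_re, mul_zero, ofReal_im, I_im, mul_one, sub_self,
    add_zero, add_im, mul_im, zero_add] at h
  linear_combination h

/-- **The staircase identity.** For `f` holomorphic on `Re z > a`, `c > a`, abscissae `s j > a`
and heights `t j` (`m ≥ 1` blocks, the `j`-th being `Re z = s j`, `t j ≤ Im z ≤ t (j+1)`):
`I•∫_{t 0}^{t m} f(c+iu) du = Σ_{j<m} I•∫_{t j}^{t (j+1)} f(s j+iu) du`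
`  + Σ_{j ∈ [1,m)} ∫_{s (j−1)}^{s j} f(v+i t j) dv + ∫_{s (m−1)}^{c} f(v+i t m) dv − ∫_{s 0}^{c} f(v+i t 0) dv`.
[folklore] -/
theorem integral_vertical_eq_staircase (hf : DifferentiableOn ℂ f {z : ℂ | a < z.re}) (hc : a < c)
    (s t : ℕ → ℝ) (hs : ∀ j, a < s j) {m : ℕ} (hm : 1 ≤ m) :
    I • ∫ u in (t 0)..(t m), f (c + u * I) =
      (∑ j ∈ Finset.range m, I • ∫ u in (t j)..(t (j + 1)), f (s j + u * I)) +
        (∑ j ∈ Finset.Ico 1 m, ∫ v in (s (j - 1))..(s j), f (v + t j * I)) +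
        (∫ v in (s (m - 1))..c, f (v + t m * I)) - ∫ v in (s 0)..c, f (v + t 0 * I) := by
  induction m, hm using Nat.le_induction with
  | base =>
    rw [Finset.sum_range_one, Finset.Ico_self, Finset.sum_empty, add_zero]
    have h := integral_vertical_eq_rect hf hc (hs 0) (t 0) (t 1)
    simp only [Nat.sub_self]
    rw [h]; ring
  | succ m hm ih =>
    -- split the vertical integral at `t m` and use the rectangle `[s m, c] × [t m, t (m+1)]`
    have hcv := continuous_vertical hf hc
    have hsplit : ∫ u in (t 0)..(t (m + 1)), f (c + u * I) =
        (∫ u in (t 0)..(t m), f (c + u * I)) + ∫ u in (t m)..(t (m + 1)), f (c + u * I) :=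
      (intervalIntegral.integral_add_adjacent_intervals (hcv.intervalIntegrable _ _)
        (hcv.intervalIntegrable _ _)).symm
    have hrect := integral_vertical_eq_rect hf hc (hs m) (t m) (t (m + 1))
    -- the connector: `∫_{s(m-1)}^{c} − ∫_{s m}^{c} = ∫_{s(m-1)}^{s m}` at height `t m`
    have hconn : (∫ v in (s (m - 1))..c, f (v + t m * I)) - ∫ v in (s m)..c, f (v + t m * I) =
        ∫ v in (s (m - 1))..(s m), f (v + t m * I) := by
      rw [sub_eq_iff_eq_add, intervalIntegral.integral_add_adjacent_intervals
        (intervalIntegrable_horizontal hf _ (hs _) (hs _)) (intervalIntegrable_horizontal hf _ (hs _) hc)]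
    rw [hsplit, smul_add, ih, hrect, Finset.sum_range_succ, Finset.sum_Ico_succ_top hm,
      show m + 1 - 1 = m from rfl]
    linear_combination hconn

/-- **The staircase bound.** Under the hypotheses of `integral_vertical_eq_staircase`:
`‖∫_{t 0}^{t m} f(c+iu) du‖ ≤ Σ_{j<m} |∫_{t j}^{t(j+1)} ‖f(s j+iu)‖ du| + Σ_{1≤j<m} |∫_{s(j−1)}^{s j} ‖f(v+i t j)‖ dv|`
`  + |∫_{s(m−1)}^{c} ‖f(v + i t m)‖ dv| + |∫_{s 0}^{c} ‖f(v + i t 0)‖ dv|`. [folklore] -/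
theorem norm_integral_vertical_le (hf : DifferentiableOn ℂ f {z : ℂ | a < z.re}) (hc : a < c)
    (s t : ℕ → ℝ) (hs : ∀ j, a < s j) {m : ℕ} (hm : 1 ≤ m) :
    ‖∫ u in (t 0)..(t m), f (c + u * I)‖ ≤
      (∑ j ∈ Finset.range m, |∫ u in (t j)..(t (j + 1)), ‖f (s j + u * I)‖|) +
        (∑ j ∈ Finset.Ico 1 m, |∫ v in (s (j - 1))..(s j), ‖f (v + t j * I)‖|) +
        |∫ v in (s (m - 1))..c, ‖f (v + t m * I)‖| + |∫ v in (s 0)..c, ‖f (v + t 0 * I)‖| := by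
  have h := integral_vertical_eq_staircase hf hc s t hs hm
  have hI : ‖∫ u in (t 0)..(t m), f (c + u * I)‖ = ‖I • ∫ u in (t 0)..(t m), f (c + u * I)‖ := by
    rw [norm_smul, Complex.norm_I, one_mul]
  rw [hI, h]
  have b1 : ‖∑ j ∈ Finset.range m, I • ∫ u in (t j)..(t (j + 1)), f (s j + u * I)‖ ≤
      ∑ j ∈ Finset.range m, |∫ u in (t j)..(t (j + 1)), ‖f (s j + u * I)‖| := by
    refine (norm_sum_le _ _).trans (Finset.sum_le_sum fun j _ ↦ ?_)
    rw [norm_smul, Complex.norm_I, one_mul]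
    exact intervalIntegral.norm_integral_le_abs_integral_norm
  have b2 : ‖∑ j ∈ Finset.Ico 1 m, ∫ v in (s (j - 1))..(s j), f (v + t j * I)‖ ≤
      ∑ j ∈ Finset.Ico 1 m, |∫ v in (s (j - 1))..(s j), ‖f (v + t j * I)‖| :=
    (norm_sum_le _ _).trans (Finset.sum_le_sum fun j _ ↦
      intervalIntegral.norm_integral_le_abs_integral_norm)
  have b3 : ‖∫ v in (s (m - 1))..c, f (v + t m * I)‖ ≤ |∫ v in (s (m - 1))..c, ‖f (v + t m * I)‖| :=
    intervalIntegral.norm_integral_le_abs_integral_norm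
  have b4 : ‖∫ v in (s 0)..c, f (v + t 0 * I)‖ ≤ |∫ v in (s 0)..c, ‖f (v + t 0 * I)‖| :=
    intervalIntegral.norm_integral_le_abs_integral_norm
  calc ‖(∑ j ∈ Finset.range m, I • ∫ u in (t j)..(t (j + 1)), f (s j + u * I)) +
        (∑ j ∈ Finset.Ico 1 m, ∫ v in (s (j - 1))..(s j), f (v + t j * I)) +
        (∫ v in (s (m - 1))..c, f (v + t m * I)) - ∫ v in (s 0)..c, f (v + t 0 * I)‖
      ≤ ‖(∑ j ∈ Finset.range m, I • ∫ u in (t j)..(t (j + 1)), f (s j + u * I)) +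
          (∑ j ∈ Finset.Ico 1 m, ∫ v in (s (j - 1))..(s j), f (v + t j * I)) +
          (∫ v in (s (m - 1))..c, f (v + t m * I))‖ + ‖∫ v in (s 0)..c, f (v + t 0 * I)‖ :=
        norm_sub_le _ _
    _ ≤ ‖(∑ j ∈ Finset.range m, I • ∫ u in (t j)..(t (j + 1)), f (s j + u * I))‖ +
          ‖(∑ j ∈ Finset.Ico 1 m, ∫ v in (s (j - 1))..(s j), f (v + t j * I))‖ +
          ‖(∫ v in (s (m - 1))..c, f (v + t m * I))‖ + ‖∫ v in (s 0)..c, f (v + t 0 * I)‖ := by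
        gcongr
        exact (norm_add_le _ _).trans (add_le_add (norm_add_le _ _) le_rfl)
    _ ≤ _ := by linarith

end Staircase

end Literature.Analysis.Complex

end
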